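import Literature.AnabelianGeometry.SemiGraphs.TemperedReconstructionCor39Finite
import Literature.AnabelianGeometry.SemiGraphs.TemperedAnchoredCompactOfLocallyFinite
import Literature.AnabelianGeometry.SemiGraphs.ThetaRayCor39
import HarnessLib

/-!
# [SemiAnbd] Corollary 3.9 (up to twist) at LOCALLY FINITE pairs, under the kernel-exact residual
# hypothesis «every compact element is verticial» (row COR39@LOCFIN)

Mochizuki, *Semi-graphs of anabelioids*, Publ. RIMS **42** (2006), §3, Corollary 3.9 and its proof,
manuscript pp. 42–43 (proof p. 43 l. 13–15: "[again by Theorem 3.7, (iii), (iv)]")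
[cite: MochizukiSemiAnbd2006, Cor 3.9 pp.42-43].

PROOF-ONLY file (0 definitions) of the abc-iut cell, layer L3, L3-lead ruling β3 (4) row «COR39@LOCFIN»
(seat abc-iut-L3-t10 gen 6).  The cell's per-pair closer of record for Cor. 3.9 over the compatible
reading of Def. 3.8, "induced" read up to the 2-cells of Rmk. 2.4.2 (`cor39UpToTwistAt`, abc-iut-w4-d080,
`TemperedReconstructionCor39UpToTwistAssemblyAt.lean`), takes exactly Theorem 3.7 (iii) AT `G` and AT
`H` (`CompactInVerticialAt`).  At FINITE graphs that input is a theorem (abc-iut-L3-t8,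
`compactInVerticialAt_of_finiteGraph`; whence `cor39UpToTwistAt_of_finite`, abc-iut-w4-d064).  At
infinite countable graphs it FAILS in general — the θ-ray `𝒢_θ` satisfies the hypotheses of Cor. 3.9, is
LOCALLY FINITE, and carries a procyclic compact subgroup lying in no verticial subgroup
(`thetaRayFreeProP_not_compactInVerticialAt`, abc-iut-L3-d4).  abc-iut-w6-d062's elementwise reduction
(`compactInVerticialAt_iff_forall_mem_exists_verticial_of_isLocallyFinite`,
`TemperedAnchoredCompactOfLocallyFinite.lean`) shows that at a LOCALLY FINITE graph Theorem 3.7 (iii) at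
the graph is EQUIVALENT to the single-element sentence

  (CE)  every element of every compact subgroup of `π₁^temp(G)` lies in some verticial subgroup

("every compact element is verticial") — the kernel-exact residual at locally finite graphs.  This file
knits, BY NAME and with no new argument:

* `compactInVerticialAt_of_forall_mem_of_isLocallyFinite` — (CE) ⇒ Thm. 3.7 (iii) at a locally finite
  graph (the `mpr` half of abc-iut-w6-d062's iff, with the `Thm37Hypotheses` guard fed from the context);
* `cor39UpToTwistAt_of_isLocallyFinite` / `cor39UpToTwist_baseAt_of_isLocallyFinite` /
  `cor39CompatUpToTwistAt_of_isLocallyFinite` — **Corollary 3.9 (a) + (b) with uniqueness, up to twist,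
  at every pair of LOCALLY FINITE graphs `G`, `H` as in Cor. 3.9 satisfying (CE)**, in the three
  currencies of the finite file (vertex/edge maps; full underlying morphism; the named `InducesUpToTwist`);
* `cor39UpToTwistAt_of_finite_of_isLocallyFinite` — the mixed pair (finite source, locally finite target
  satisfying (CE)), the shape tempered coverings of a finite graph present;
* `forall_mem_exists_verticial_of_finiteGraph` + two `example`s — (CE) HOLDS at finite graphs, and
  the finite theorems of record (`cor39UpToTwistAt_of_finite` / `cor39CompatUpToTwistAt_of_finite`,
  p431134) RE-DERIVED, statements verbatim, as the finite case of the locally finite closers (as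
  `example`s: a verbatim restatement is not a second declaration);
* `thetaRayFreeProP_not_forall_mem_exists_verticial` /
  `not_forall_cor39Hypotheses_isLocallyFinite_forall_mem_exists_verticial` — (CE) is NOT implied by the
  hypotheses of Cor. 3.9 plus local finiteness (it fails at `𝒢_θ(p, n)`), so the residual hypothesis of
  the locally finite closers is genuine, not idle.

HONEST FRAMING.  OUR rendering of a refereed paper's Cor. 3.9 at OUR typed objects; the literal
chosen-conjugator `Cor39` stays refuted/open as recorded elsewhere; nothing here bears on [IUTchIII]
Cor. 3.12 and nothing asserts abc proved or refuted.  typed ≠ proved.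
-/

open CategoryTheory

namespace Literature.AnabelianGeometry.SemiGraphs

namespace ProfiniteSemiGraph

universe u

variable {𝒢 ℋ : ProfiniteSemiGraph.{u}}

/-! ### (CE) ⇒ Theorem 3.7 (iii) at a locally finite graph -/

/-- **(CE) ⇒ Thm. 3.7 (iii) AT a locally finite graph** (abc-iut-w6-d062's
`compactInVerticialAt_iff_forall_mem_exists_verticial_of_isLocallyFinite`, `mpr` half, the
`Thm37Hypotheses` guard supplied by the consumer): if every element of every compact subgroup of every
chart of `π₁^temp(G)` lies in a verticial subgroup, then every compact subgroup lies in one.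
[cite: MochizukiSemiAnbd2006, Thm 3.7(iii) pp.40-41] -/
theorem compactInVerticialAt_of_forall_mem_of_isLocallyFinite (hlf : 𝒢.graph.IsLocallyFinite)
    (hce : ∀ (c : TemperedPiChart 𝒢) (K : Subgroup c.G), IsCompact (K : Set c.G) →
      ∀ g ∈ K, ∃ (v : 𝒢.graph.Vertex) (H : Subgroup c.G), H ∈ verticialSubgroups c v ∧ g ∈ H) :
    CompactInVerticialAt 𝒢 :=
  (𝒢.compactInVerticialAt_iff_forall_mem_exists_verticial_of_isLocallyFinite hlf).mpr fun _ => hce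

/-- Conversely, at a locally finite graph satisfying the hypotheses of Thm. 3.7, Thm. 3.7 (iii) at the
graph gives (CE) (the `mp` half; recorded for the finite re-derivation below).
[cite: MochizukiSemiAnbd2006, Thm 3.7(iii) pp.40-41] -/
theorem forall_mem_exists_verticial_of_compactInVerticialAt_of_isLocallyFinite
    (h37 : 𝒢.Thm37Hypotheses) (hlf : 𝒢.graph.IsLocallyFinite) (hiii : CompactInVerticialAt 𝒢)
    (c : TemperedPiChart 𝒢) (K : Subgroup c.G) (hK : IsCompact (K : Set c.G)) :
    ∀ g ∈ K, ∃ (v : 𝒢.graph.Vertex) (H : Subgroup c.G), H ∈ verticialSubgroups c v ∧ g ∈ H :=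
  (𝒢.compactInVerticialAt_iff_forall_mem_exists_verticial_of_isLocallyFinite hlf).mp hiii h37 c K hK

/-! ### Corollary 3.9, up to twist, at a pair of locally finite graphs satisfying (CE) -/

/-- **[SemiAnbd] Corollary 3.9 at a pair of LOCALLY FINITE graphs `G`, `H` as in Cor. 3.9, each
satisfying (CE) «every compact element is verticial» — up to twist**: (a) a homomorphism
`π₁^temp(G) → π₁^temp(H)` induced up to twist by a locally open morphism is compatibly quasi-geometric;
(b) every compatibly quasi-geometric homomorphism is so induced by a locally open morphism, with unique
vertex and edge maps.  (`cor39UpToTwistAt` of abc-iut-w4-d080 with both Thm. 3.7 (iii) inputs supplied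
by `compactInVerticialAt_of_forall_mem_of_isLocallyFinite`.) [cite: MochizukiSemiAnbd2006, Cor 3.9 pp.42-43] -/
theorem cor39UpToTwistAt_of_isLocallyFinite (hlf𝒢 : 𝒢.graph.IsLocallyFinite)
    (hlfℋ : ℋ.graph.IsLocallyFinite)
    (hce𝒢 : ∀ (c : TemperedPiChart 𝒢) (K : Subgroup c.G), IsCompact (K : Set c.G) →
      ∀ g ∈ K, ∃ (v : 𝒢.graph.Vertex) (H : Subgroup c.G), H ∈ verticialSubgroups c v ∧ g ∈ H)
    (hceℋ : ∀ (c : TemperedPiChart ℋ) (K : Subgroup c.G), IsCompact (K : Set c.G) →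
      ∀ g ∈ K, ∃ (v : ℋ.graph.Vertex) (H : Subgroup c.G), H ∈ verticialSubgroups c v ∧ g ∈ H)
    (h𝒢 : Cor39Hypotheses 𝒢) (hℋ : Cor39Hypotheses ℋ) (c𝒢 : TemperedPiChart 𝒢)
    (cℋ : TemperedPiChart ℋ) :
    (∀ (F : Hom 𝒢 ℋ), F.IsLocallyOpen → ∀ φ : c𝒢.G →ₜ* cℋ.G,
        (∃ θ : F.ConjugatorFamily, Nonempty (F.chartPullbackWith θ c𝒢 cℋ ≅ BTemp.res φ)) →
          IsCompatiblyQuasiGeometric φ) ∧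
      ∀ φ : c𝒢.G →ₜ* cℋ.G, IsCompatiblyQuasiGeometric φ →
        ∃ F : Hom 𝒢 ℋ, F.IsLocallyOpen ∧
          (∃ θ : F.ConjugatorFamily, Nonempty (F.chartPullbackWith θ c𝒢 cℋ ≅ BTemp.res φ)) ∧
          ∀ F' : Hom 𝒢 ℋ, F'.IsLocallyOpen →
            (∃ θ' : F'.ConjugatorFamily, Nonempty (F'.chartPullbackWith θ' c𝒢 cℋ ≅ BTemp.res φ)) →
              F'.base.vertexMap = F.base.vertexMap ∧ F'.base.edgeMap = F.base.edgeMap :=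
  cor39UpToTwistAt (compactInVerticialAt_of_forall_mem_of_isLocallyFinite hlf𝒢 hce𝒢)
    (compactInVerticialAt_of_forall_mem_of_isLocallyFinite hlfℋ hceℋ) h𝒢 hℋ c𝒢 cℋ

/-- **The same with FULL uniqueness of the underlying morphism of semi-graphs** (vertex, edge and branch
maps), at a pair of locally finite graphs satisfying (CE). [cite: MochizukiSemiAnbd2006, Cor 3.9 pp.42-43] -/
theorem cor39UpToTwist_baseAt_of_isLocallyFinite (hlf𝒢 : 𝒢.graph.IsLocallyFinite)
    (hlfℋ : ℋ.graph.IsLocallyFinite)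
    (hce𝒢 : ∀ (c : TemperedPiChart 𝒢) (K : Subgroup c.G), IsCompact (K : Set c.G) →
      ∀ g ∈ K, ∃ (v : 𝒢.graph.Vertex) (H : Subgroup c.G), H ∈ verticialSubgroups c v ∧ g ∈ H)
    (hceℋ : ∀ (c : TemperedPiChart ℋ) (K : Subgroup c.G), IsCompact (K : Set c.G) →
      ∀ g ∈ K, ∃ (v : ℋ.graph.Vertex) (H : Subgroup c.G), H ∈ verticialSubgroups c v ∧ g ∈ H)
    (h𝒢 : Cor39Hypotheses 𝒢) (hℋ : Cor39Hypotheses ℋ) (c𝒢 : TemperedPiChart 𝒢)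
    (cℋ : TemperedPiChart ℋ) :
    (∀ (F : Hom 𝒢 ℋ), F.IsLocallyOpen → ∀ φ : c𝒢.G →ₜ* cℋ.G,
        (∃ θ : F.ConjugatorFamily, Nonempty (F.chartPullbackWith θ c𝒢 cℋ ≅ BTemp.res φ)) →
          IsCompatiblyQuasiGeometric φ) ∧
      ∀ φ : c𝒢.G →ₜ* cℋ.G, IsCompatiblyQuasiGeometric φ →
        ∃ F : Hom 𝒢 ℋ, F.IsLocallyOpen ∧
          (∃ θ : F.ConjugatorFamily, Nonempty (F.chartPullbackWith θ c𝒢 cℋ ≅ BTemp.res φ)) ∧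
          ∀ F' : Hom 𝒢 ℋ, F'.IsLocallyOpen →
            (∃ θ' : F'.ConjugatorFamily, Nonempty (F'.chartPullbackWith θ' c𝒢 cℋ ≅ BTemp.res φ)) →
              F'.base = F.base :=
  cor39UpToTwist_baseAt (compactInVerticialAt_of_forall_mem_of_isLocallyFinite hlf𝒢 hce𝒢)
    (compactInVerticialAt_of_forall_mem_of_isLocallyFinite hlfℋ hceℋ) h𝒢 hℋ c𝒢 cℋ

/-- **[SemiAnbd] Corollary 3.9 at a pair of LOCALLY FINITE graphs satisfying (CE), in the NAMED
currency `InducesUpToTwist`** (the body of abc-iut-w4-d080's `Cor39CompatUpToTwist` at the pair): (a)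
`F.InducesUpToTwist φ` for a locally open `F` ⇒ `φ` compatibly quasi-geometric; (b) every compatibly
quasi-geometric `φ` is `InducesUpToTwist`-induced by a locally open `F`, unique as a morphism of the
underlying semi-graphs. [cite: MochizukiSemiAnbd2006, Cor 3.9 pp.42-43] -/
theorem cor39CompatUpToTwistAt_of_isLocallyFinite (hlf𝒢 : 𝒢.graph.IsLocallyFinite)
    (hlfℋ : ℋ.graph.IsLocallyFinite)
    (hce𝒢 : ∀ (c : TemperedPiChart 𝒢) (K : Subgroup c.G), IsCompact (K : Set c.G) →
      ∀ g ∈ K, ∃ (v : 𝒢.graph.Vertex) (H : Subgroup c.G), H ∈ verticialSubgroups c v ∧ g ∈ H)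
    (hceℋ : ∀ (c : TemperedPiChart ℋ) (K : Subgroup c.G), IsCompact (K : Set c.G) →
      ∀ g ∈ K, ∃ (v : ℋ.graph.Vertex) (H : Subgroup c.G), H ∈ verticialSubgroups c v ∧ g ∈ H)
    (h𝒢 : Cor39Hypotheses 𝒢) (hℋ : Cor39Hypotheses ℋ) (c𝒢 : TemperedPiChart 𝒢)
    (cℋ : TemperedPiChart ℋ) :
    (∀ (F : Hom 𝒢 ℋ), F.IsLocallyOpen → ∀ φ : c𝒢.G →ₜ* cℋ.G, F.InducesUpToTwist c𝒢 cℋ φ →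
        IsCompatiblyQuasiGeometric φ) ∧
      ∀ φ : c𝒢.G →ₜ* cℋ.G, IsCompatiblyQuasiGeometric φ →
        ∃ F : Hom 𝒢 ℋ, F.IsLocallyOpen ∧ F.InducesUpToTwist c𝒢 cℋ φ ∧
          ∀ F' : Hom 𝒢 ℋ, F'.IsLocallyOpen → F'.InducesUpToTwist c𝒢 cℋ φ → F'.base = F.base :=
  cor39CompatUpToTwistAt (compactInVerticialAt_of_forall_mem_of_isLocallyFinite hlf𝒢 hce𝒢)
    (compactInVerticialAt_of_forall_mem_of_isLocallyFinite hlfℋ hceℋ) h𝒢 hℋ c𝒢 cℋ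

/-! ### The mixed pair: finite source, locally finite target satisfying (CE) -/

/-- **Corollary 3.9, up to twist, for `G` FINITE and `H` LOCALLY FINITE satisfying (CE)** (the shape in
which a finite graph of anabelioids maps to / is covered by an infinite locally finite one): Thm. 3.7
(iii) at `G` by `compactInVerticialAt_of_finiteGraph`, at `H` by (CE).
[cite: MochizukiSemiAnbd2006, Cor 3.9 pp.42-43] -/
theorem cor39UpToTwistAt_of_finite_of_isLocallyFinite [Finite 𝒢.graph.Vertex] [Finite 𝒢.graph.Edge]
    (hlfℋ : ℋ.graph.IsLocallyFinite)
    (hceℋ : ∀ (c : TemperedPiChart ℋ) (K : Subgroup c.G), IsCompact (K : Set c.G) →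
      ∀ g ∈ K, ∃ (v : ℋ.graph.Vertex) (H : Subgroup c.G), H ∈ verticialSubgroups c v ∧ g ∈ H)
    (h𝒢 : Cor39Hypotheses 𝒢) (hℋ : Cor39Hypotheses ℋ) (c𝒢 : TemperedPiChart 𝒢)
    (cℋ : TemperedPiChart ℋ) :
    (∀ (F : Hom 𝒢 ℋ), F.IsLocallyOpen → ∀ φ : c𝒢.G →ₜ* cℋ.G,
        (∃ θ : F.ConjugatorFamily, Nonempty (F.chartPullbackWith θ c𝒢 cℋ ≅ BTemp.res φ)) →
          IsCompatiblyQuasiGeometric φ) ∧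
      ∀ φ : c𝒢.G →ₜ* cℋ.G, IsCompatiblyQuasiGeometric φ →
        ∃ F : Hom 𝒢 ℋ, F.IsLocallyOpen ∧
          (∃ θ : F.ConjugatorFamily, Nonempty (F.chartPullbackWith θ c𝒢 cℋ ≅ BTemp.res φ)) ∧
          ∀ F' : Hom 𝒢 ℋ, F'.IsLocallyOpen →
            (∃ θ' : F'.ConjugatorFamily, Nonempty (F'.chartPullbackWith θ' c𝒢 cℋ ≅ BTemp.res φ)) →
              F'.base.vertexMap = F.base.vertexMap ∧ F'.base.edgeMap = F.base.edgeMap :=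
  cor39UpToTwistAt compactInVerticialAt_of_finiteGraph
    (compactInVerticialAt_of_forall_mem_of_isLocallyFinite hlfℋ hceℋ) h𝒢 hℋ c𝒢 cℋ

/-- The symmetric mixed pair: `G` LOCALLY FINITE satisfying (CE), `H` FINITE.
[cite: MochizukiSemiAnbd2006, Cor 3.9 pp.42-43] -/
theorem cor39UpToTwistAt_of_isLocallyFinite_of_finite (hlf𝒢 : 𝒢.graph.IsLocallyFinite)
    (hce𝒢 : ∀ (c : TemperedPiChart 𝒢) (K : Subgroup c.G), IsCompact (K : Set c.G) →
      ∀ g ∈ K, ∃ (v : 𝒢.graph.Vertex) (H : Subgroup c.G), H ∈ verticialSubgroups c v ∧ g ∈ H)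
    [Finite ℋ.graph.Vertex] [Finite ℋ.graph.Edge]
    (h𝒢 : Cor39Hypotheses 𝒢) (hℋ : Cor39Hypotheses ℋ) (c𝒢 : TemperedPiChart 𝒢)
    (cℋ : TemperedPiChart ℋ) :
    (∀ (F : Hom 𝒢 ℋ), F.IsLocallyOpen → ∀ φ : c𝒢.G →ₜ* cℋ.G,
        (∃ θ : F.ConjugatorFamily, Nonempty (F.chartPullbackWith θ c𝒢 cℋ ≅ BTemp.res φ)) →
          IsCompatiblyQuasiGeometric φ) ∧
      ∀ φ : c𝒢.G →ₜ* cℋ.G, IsCompatiblyQuasiGeometric φ →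
        ∃ F : Hom 𝒢 ℋ, F.IsLocallyOpen ∧
          (∃ θ : F.ConjugatorFamily, Nonempty (F.chartPullbackWith θ c𝒢 cℋ ≅ BTemp.res φ)) ∧
          ∀ F' : Hom 𝒢 ℋ, F'.IsLocallyOpen →
            (∃ θ' : F'.ConjugatorFamily, Nonempty (F'.chartPullbackWith θ' c𝒢 cℋ ≅ BTemp.res φ)) →
              F'.base.vertexMap = F.base.vertexMap ∧ F'.base.edgeMap = F.base.edgeMap :=
  cor39UpToTwistAt (compactInVerticialAt_of_forall_mem_of_isLocallyFinite hlf𝒢 hce𝒢)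
    compactInVerticialAt_of_finiteGraph h𝒢 hℋ c𝒢 cℋ

/-! ### The finite case RE-DERIVED from the locally finite one -/

/-- A finite semi-graph is locally finite. [cite: MochizukiSemiAnbd2006, §1 p.13] -/
theorem isLocallyFinite_of_finite_edge [Finite 𝒢.graph.Edge] : 𝒢.graph.IsLocallyFinite :=
  ⟨fun _ => Set.toFinite _⟩

/-- **(CE) HOLDS at every FINITE graph as in Thm. 3.7** (every chart): every element of every compact
subgroup of `π₁^temp(G)` lies in a verticial subgroup — Thm. 3.7 (iii) at the finite graph
(`compactInVerticialAt_of_finiteGraph`, abc-iut-L3-t8) read elementwise.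
[cite: MochizukiSemiAnbd2006, Thm 3.7(iii) pp.40-41] -/
theorem forall_mem_exists_verticial_of_finiteGraph [Finite 𝒢.graph.Vertex] [Finite 𝒢.graph.Edge]
    (h37 : 𝒢.Thm37Hypotheses) (c : TemperedPiChart 𝒢) (K : Subgroup c.G)
    (hK : IsCompact (K : Set c.G)) :
    ∀ g ∈ K, ∃ (v : 𝒢.graph.Vertex) (H : Subgroup c.G), H ∈ verticialSubgroups c v ∧ g ∈ H :=
  forall_mem_exists_verticial_of_compactInVerticialAt_of_isLocallyFinite h37 isLocallyFinite_of_finite_edge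
    compactInVerticialAt_of_finiteGraph c K hK

/- **The finite theorem of record RE-DERIVED** — statement verbatim that of
`cor39UpToTwistAt_of_finite` (abc-iut-w4-d064, p431134) — as the finite case of
`cor39UpToTwistAt_of_isLocallyFinite`: a finite graph is locally finite and satisfies (CE).  Recorded as
an `example` (a verbatim restatement may not be a second declaration); the kernel checks that the
locally finite closer specialises to the statement of record on the nose.
[cite: MochizukiSemiAnbd2006, Cor 3.9 pp.42-43] -/
example [Finite 𝒢.graph.Vertex] [Finite 𝒢.graph.Edge]
    [Finite ℋ.graph.Vertex] [Finite ℋ.graph.Edge] (h𝒢 : Cor39Hypotheses 𝒢) (hℋ : Cor39Hypotheses ℋ)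
    (c𝒢 : TemperedPiChart 𝒢) (cℋ : TemperedPiChart ℋ) :
    (∀ (F : Hom 𝒢 ℋ), F.IsLocallyOpen → ∀ φ : c𝒢.G →ₜ* cℋ.G,
        (∃ θ : F.ConjugatorFamily, Nonempty (F.chartPullbackWith θ c𝒢 cℋ ≅ BTemp.res φ)) →
          IsCompatiblyQuasiGeometric φ) ∧
      ∀ φ : c𝒢.G →ₜ* cℋ.G, IsCompatiblyQuasiGeometric φ →
        ∃ F : Hom 𝒢 ℋ, F.IsLocallyOpen ∧
          (∃ θ : F.ConjugatorFamily, Nonempty (F.chartPullbackWith θ c𝒢 cℋ ≅ BTemp.res φ)) ∧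
          ∀ F' : Hom 𝒢 ℋ, F'.IsLocallyOpen →
            (∃ θ' : F'.ConjugatorFamily, Nonempty (F'.chartPullbackWith θ' c𝒢 cℋ ≅ BTemp.res φ)) →
              F'.base.vertexMap = F.base.vertexMap ∧ F'.base.edgeMap = F.base.edgeMap :=
  cor39UpToTwistAt_of_isLocallyFinite isLocallyFinite_of_finite_edge isLocallyFinite_of_finite_edge
    (fun c K hK => forall_mem_exists_verticial_of_finiteGraph h𝒢.thm37Hypotheses c K hK)
    (fun c K hK => forall_mem_exists_verticial_of_finiteGraph hℋ.thm37Hypotheses c K hK) h𝒢 hℋ c𝒢 cℋ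

/- The named-currency finite theorem of record (`cor39CompatUpToTwistAt_of_finite`, p431134)
RE-DERIVED likewise, statement verbatim, as an `example`. [cite: MochizukiSemiAnbd2006, Cor 3.9 pp.42-43] -/
example [Finite 𝒢.graph.Vertex] [Finite 𝒢.graph.Edge]
    [Finite ℋ.graph.Vertex] [Finite ℋ.graph.Edge] (h𝒢 : Cor39Hypotheses 𝒢) (hℋ : Cor39Hypotheses ℋ)
    (c𝒢 : TemperedPiChart 𝒢) (cℋ : TemperedPiChart ℋ) :
    (∀ (F : Hom 𝒢 ℋ), F.IsLocallyOpen → ∀ φ : c𝒢.G →ₜ* cℋ.G, F.InducesUpToTwist c𝒢 cℋ φ →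
        IsCompatiblyQuasiGeometric φ) ∧
      ∀ φ : c𝒢.G →ₜ* cℋ.G, IsCompatiblyQuasiGeometric φ →
        ∃ F : Hom 𝒢 ℋ, F.IsLocallyOpen ∧ F.InducesUpToTwist c𝒢 cℋ φ ∧
          ∀ F' : Hom 𝒢 ℋ, F'.IsLocallyOpen → F'.InducesUpToTwist c𝒢 cℋ φ → F'.base = F.base :=
  cor39CompatUpToTwistAt_of_isLocallyFinite isLocallyFinite_of_finite_edge isLocallyFinite_of_finite_edge
    (fun c K hK => forall_mem_exists_verticial_of_finiteGraph h𝒢.thm37Hypotheses c K hK)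
    (fun c K hK => forall_mem_exists_verticial_of_finiteGraph hℋ.thm37Hypotheses c K hK) h𝒢 hℋ c𝒢 cℋ

/-! ### (CE) is a genuine hypothesis: it fails at the locally finite θ-ray -/

section ThetaRay

variable (p : ℕ) [hp : Fact p.Prime] (n : ℕ → ℕ)

/-- **(CE) FAILS at `𝒢_θ(p, n)`** (`n` pointwise above the identity), although `𝒢_θ` satisfies the
hypotheses of Cor. 3.9 and is locally finite: some element of some compact subgroup of some chart of
`π₁^temp(𝒢_θ)` lies in no verticial subgroup (abc-iut-L3-d4's `thetaRayFreeProP_not_compactInVerticialAt`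
through abc-iut-w6-d062's elementwise iff). [cite: MochizukiSemiAnbd2006, Thm 3.7(iii) pp.40-41] -/
theorem thetaRayFreeProP_not_forall_mem_exists_verticial (hn : ∀ k, k ≤ n k) :
    ¬ ∀ (c : TemperedPiChart (thetaRayFreeProP p n)) (K : Subgroup c.G), IsCompact (K : Set c.G) →
      ∀ g ∈ K, ∃ (v : (thetaRayFreeProP p n).graph.Vertex) (H : Subgroup c.G),
        H ∈ verticialSubgroups c v ∧ g ∈ H := fun hce =>
  thetaRayFreeProP_not_compactInVerticialAt p n hn
    (compactInVerticialAt_of_forall_mem_of_isLocallyFinite SemiGraph.ray_isLocallyFinite hce)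

/-- **The residual hypothesis of the locally finite closers is NOT implied by the hypotheses of Cor. 3.9
plus local finiteness**: countermodel `𝒢_θ(2, k ↦ k + 1)`. [cite: MochizukiSemiAnbd2006, Cor 3.9 p.42] -/
theorem not_forall_cor39Hypotheses_isLocallyFinite_forall_mem_exists_verticial :
    ¬ ∀ 𝒢 : ProfiniteSemiGraph.{0}, Cor39Hypotheses 𝒢 → 𝒢.graph.IsLocallyFinite →
      ∀ (c : TemperedPiChart 𝒢) (K : Subgroup c.G), IsCompact (K : Set c.G) →
        ∀ g ∈ K, ∃ (v : 𝒢.graph.Vertex) (H : Subgroup c.G), H ∈ verticialSubgroups c v ∧ g ∈ H :=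
  fun h =>
  haveI : Fact (Nat.Prime 2) := ⟨Nat.prime_two⟩
  thetaRayFreeProP_not_forall_mem_exists_verticial 2 (fun k => k + 1) (fun k => Nat.le_succ k)
    (h _ (thetaRayFreeProP_cor39Hypotheses 2 fun k => k + 1) SemiGraph.ray_isLocallyFinite)

end ThetaRay

/-! ### v2 (append-only): the residual in the literal «compact ELEMENT» currency
(`g` is a *compact element* when `closure ⟨g⟩` is compact; (CE) ⟺ every compact element is verticial,
since compact subgroups of the Hausdorff `π₁^temp(G)` are closed — so consumers may discharge the
residual binder ONE ELEMENT AT A TIME) -/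

/-- A compact subgroup contains the closed procyclic subgroup generated by each of its elements, which is
therefore compact (`π₁^temp(G)` is Hausdorff). [folklore] -/
private theorem isCompact_topologicalClosure_zpowers_of_mem (c : TemperedPiChart 𝒢) (K : Subgroup c.G)
    (hK : IsCompact (K : Set c.G)) {g : c.G} (hg : g ∈ K) :
    IsCompact ((Subgroup.zpowers g).topologicalClosure : Set c.G) := by
  haveI : T2Space c.G := c.t2Space
  have hle : (Subgroup.zpowers g).topologicalClosure ≤ K :=
    Subgroup.topologicalClosure_minimal _ ((Subgroup.zpowers_le).mpr hg) hK.isClosed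
  exact hK.of_isClosed_subset (Subgroup.isClosed_topologicalClosure _) hle

/-- **(CE) ⟺ «every compact ELEMENT is verticial»** at ANY graph and chart (no local finiteness needed
for this equivalence): every element of every compact subgroup lies in a verticial subgroup iff every
element topologically generating a compact subgroup does. [cite: MochizukiSemiAnbd2006, Thm 3.7(iii) pp.40-41] -/
theorem forall_mem_exists_verticial_iff_forall_compactElement (c : TemperedPiChart 𝒢) :
    (∀ (K : Subgroup c.G), IsCompact (K : Set c.G) →
        ∀ g ∈ K, ∃ (v : 𝒢.graph.Vertex) (H : Subgroup c.G), H ∈ verticialSubgroups c v ∧ g ∈ H) ↔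
      ∀ g : c.G, IsCompact ((Subgroup.zpowers g).topologicalClosure : Set c.G) →
        ∃ (v : 𝒢.graph.Vertex) (H : Subgroup c.G), H ∈ verticialSubgroups c v ∧ g ∈ H :=
  ⟨fun h g hg => h _ hg g (Subgroup.le_topologicalClosure _ (Subgroup.mem_zpowers g)),
    fun h K hK g hgK => h g (isCompact_topologicalClosure_zpowers_of_mem c K hK hgK)⟩

/-- **At a locally finite countable graph, Thm. 3.7 (iii) at the graph ⟺ every compact ELEMENT of every
chart of `π₁^temp(G)` lies in a verticial subgroup** (abc-iut-w6-d062's elementwise iff, re-expressed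
through `forall_mem_exists_verticial_iff_forall_compactElement`).
[cite: MochizukiSemiAnbd2006, Thm 3.7(iii) pp.40-41] -/
theorem compactInVerticialAt_iff_forall_compactElement_of_isLocallyFinite
    (hlf : 𝒢.graph.IsLocallyFinite) :
    CompactInVerticialAt 𝒢 ↔
      (𝒢.Thm37Hypotheses → ∀ (c : TemperedPiChart 𝒢) (g : c.G),
        IsCompact ((Subgroup.zpowers g).topologicalClosure : Set c.G) →
          ∃ (v : 𝒢.graph.Vertex) (H : Subgroup c.G), H ∈ verticialSubgroups c v ∧ g ∈ H) := by
  rw [𝒢.compactInVerticialAt_iff_forall_mem_exists_verticial_of_isLocallyFinite hlf]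
  exact ⟨fun h h37 c => (forall_mem_exists_verticial_iff_forall_compactElement c).mp (h h37 c),
    fun h h37 c => (forall_mem_exists_verticial_iff_forall_compactElement c).mpr (h h37 c)⟩

/-- **«every compact element verticial» ⇒ Thm. 3.7 (iii) AT a locally finite graph** (consumer
form). [cite: MochizukiSemiAnbd2006, Thm 3.7(iii) pp.40-41] -/
theorem compactInVerticialAt_of_forall_compactElement_of_isLocallyFinite (hlf : 𝒢.graph.IsLocallyFinite)
    (hel : ∀ (c : TemperedPiChart 𝒢) (g : c.G),
      IsCompact ((Subgroup.zpowers g).topologicalClosure : Set c.G) →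
        ∃ (v : 𝒢.graph.Vertex) (H : Subgroup c.G), H ∈ verticialSubgroups c v ∧ g ∈ H) :
    CompactInVerticialAt 𝒢 :=
  (𝒢.compactInVerticialAt_iff_forall_compactElement_of_isLocallyFinite hlf).mpr fun _ => hel

/-- **[SemiAnbd] Corollary 3.9, up to twist, at a pair of LOCALLY FINITE graphs each of whose compact
ELEMENTS is verticial** (the residual in its literal single-element currency; same conclusion as
`cor39UpToTwistAt_of_isLocallyFinite`). [cite: MochizukiSemiAnbd2006, Cor 3.9 pp.42-43] -/
theorem cor39UpToTwistAt_of_forall_compactElement_of_isLocallyFinite (hlf𝒢 : 𝒢.graph.IsLocallyFinite)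
    (hlfℋ : ℋ.graph.IsLocallyFinite)
    (hel𝒢 : ∀ (c : TemperedPiChart 𝒢) (g : c.G),
      IsCompact ((Subgroup.zpowers g).topologicalClosure : Set c.G) →
        ∃ (v : 𝒢.graph.Vertex) (H : Subgroup c.G), H ∈ verticialSubgroups c v ∧ g ∈ H)
    (helℋ : ∀ (c : TemperedPiChart ℋ) (g : c.G),
      IsCompact ((Subgroup.zpowers g).topologicalClosure : Set c.G) →
        ∃ (v : ℋ.graph.Vertex) (H : Subgroup c.G), H ∈ verticialSubgroups c v ∧ g ∈ H)
    (h𝒢 : Cor39Hypotheses 𝒢) (hℋ : Cor39Hypotheses ℋ) (c𝒢 : TemperedPiChart 𝒢)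
    (cℋ : TemperedPiChart ℋ) :
    (∀ (F : Hom 𝒢 ℋ), F.IsLocallyOpen → ∀ φ : c𝒢.G →ₜ* cℋ.G,
        (∃ θ : F.ConjugatorFamily, Nonempty (F.chartPullbackWith θ c𝒢 cℋ ≅ BTemp.res φ)) →
          IsCompatiblyQuasiGeometric φ) ∧
      ∀ φ : c𝒢.G →ₜ* cℋ.G, IsCompatiblyQuasiGeometric φ →
        ∃ F : Hom 𝒢 ℋ, F.IsLocallyOpen ∧
          (∃ θ : F.ConjugatorFamily, Nonempty (F.chartPullbackWith θ c𝒢 cℋ ≅ BTemp.res φ)) ∧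
          ∀ F' : Hom 𝒢 ℋ, F'.IsLocallyOpen →
            (∃ θ' : F'.ConjugatorFamily, Nonempty (F'.chartPullbackWith θ' c𝒢 cℋ ≅ BTemp.res φ)) →
              F'.base.vertexMap = F.base.vertexMap ∧ F'.base.edgeMap = F.base.edgeMap :=
  cor39UpToTwistAt (compactInVerticialAt_of_forall_compactElement_of_isLocallyFinite hlf𝒢 hel𝒢)
    (compactInVerticialAt_of_forall_compactElement_of_isLocallyFinite hlfℋ helℋ) h𝒢 hℋ c𝒢 cℋ

/-- The named-currency form (`InducesUpToTwist`) of the previous theorem. [cite: MochizukiSemiAnbd2006, Cor 3.9 pp.42-43] -/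
theorem cor39CompatUpToTwistAt_of_forall_compactElement_of_isLocallyFinite
    (hlf𝒢 : 𝒢.graph.IsLocallyFinite) (hlfℋ : ℋ.graph.IsLocallyFinite)
    (hel𝒢 : ∀ (c : TemperedPiChart 𝒢) (g : c.G),
      IsCompact ((Subgroup.zpowers g).topologicalClosure : Set c.G) →
        ∃ (v : 𝒢.graph.Vertex) (H : Subgroup c.G), H ∈ verticialSubgroups c v ∧ g ∈ H)
    (helℋ : ∀ (c : TemperedPiChart ℋ) (g : c.G),
      IsCompact ((Subgroup.zpowers g).topologicalClosure : Set c.G) →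
        ∃ (v : ℋ.graph.Vertex) (H : Subgroup c.G), H ∈ verticialSubgroups c v ∧ g ∈ H)
    (h𝒢 : Cor39Hypotheses 𝒢) (hℋ : Cor39Hypotheses ℋ) (c𝒢 : TemperedPiChart 𝒢)
    (cℋ : TemperedPiChart ℋ) :
    (∀ (F : Hom 𝒢 ℋ), F.IsLocallyOpen → ∀ φ : c𝒢.G →ₜ* cℋ.G, F.InducesUpToTwist c𝒢 cℋ φ →
        IsCompatiblyQuasiGeometric φ) ∧
      ∀ φ : c𝒢.G →ₜ* cℋ.G, IsCompatiblyQuasiGeometric φ →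
        ∃ F : Hom 𝒢 ℋ, F.IsLocallyOpen ∧ F.InducesUpToTwist c𝒢 cℋ φ ∧
          ∀ F' : Hom 𝒢 ℋ, F'.IsLocallyOpen → F'.InducesUpToTwist c𝒢 cℋ φ → F'.base = F.base :=
  cor39CompatUpToTwistAt (compactInVerticialAt_of_forall_compactElement_of_isLocallyFinite hlf𝒢 hel𝒢)
    (compactInVerticialAt_of_forall_compactElement_of_isLocallyFinite hlfℋ helℋ) h𝒢 hℋ c𝒢 cℋ

section ThetaRayElement

variable (p : ℕ) [hp : Fact p.Prime] (n : ℕ → ℕ)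

/-- **At `𝒢_θ(p, n)` there is a compact ELEMENT lying in no verticial subgroup** (some chart): the
single-element form of abc-iut-L3-d4's `thetaRayFreeProP_not_compactInVerticialAt`.
[cite: MochizukiSemiAnbd2006, Thm 3.7(iii) pp.40-41] -/
theorem thetaRayFreeProP_exists_compactElement_not_verticial (hn : ∀ k, k ≤ n k) :
    ∃ (c : TemperedPiChart (thetaRayFreeProP p n)) (g : c.G),
      IsCompact ((Subgroup.zpowers g).topologicalClosure : Set c.G) ∧
        ∀ (v : (thetaRayFreeProP p n).graph.Vertex) (H : Subgroup c.G),
          H ∈ verticialSubgroups c v → g ∉ H := by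
  by_contra hcon
  refine thetaRayFreeProP_not_compactInVerticialAt p n hn
    (compactInVerticialAt_of_forall_compactElement_of_isLocallyFinite SemiGraph.ray_isLocallyFinite
      fun c g hg => ?_)
  by_contra hno
  exact hcon ⟨c, g, hg, fun v H hH hgH => hno ⟨v, H, hH, hgH⟩⟩

end ThetaRayElement

end ProfiniteSemiGraph

end Literature.AnabelianGeometry.SemiGraphs
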